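import Literature.MathematicalPhysics.QuantumFieldTheory.Balaban1983to89.B16Eq112
import Literature.MathematicalPhysics.QuantumFieldTheory.Balaban1983to89.B16Sect1Kernels

/-!
# `Balaban1983to89.B16Prop1IVAssembly` — T. Bałaban, *Large field renormalization. II. Localization, exponentiation,
and bounds for the 𝐑 operation*, Commun. Math. Phys. **122** (1989) 355–392 [Balaban1989LargeFieldII], Sect. 1 p. 359:
the PROOF OF PROPOSITION 1 [IV] assembled (SKELETON row **B16.Prop1[IV]**; kind «implication / knitting», Phase 2 of
the mega-formalization `lit-balaban`, reader/typer block r13 gen 6; HOME `run/shared/lean/pub/lit-balaban/`, rows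
`lit-balaban-r13/ROWS-B16.md`).

statement-level skeleton of published theorems with citation tags; proofs where landed; nothing here is a claim about
the Yang–Mills mass gap

PDF held: `paper:balaban1989-cmp122-large-field-ii` (journal page = PDF page + 354); p. 359 [PDF 5] (render
`run/shared/lean/pub/pub-balaban/b2b-balaban-ref1/pages/1989-cmp122-large-field-II/…-p005-x2.png` read as an image by
r13 gen 1/3 for `B16Sect1Kernels`/`B16Eq112`).

WHAT IS REPRODUCED.  p. 359, verbatim: *"Equation (1.12) can be written as B′ + (P₀H*_{1,k}Δ₁H_{1,k}P₀)⁻¹P₀H*_{1,k}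
((δ/δA)V)(H_{1,k}B′) = −(P₀H*_{1,k}Δ₁H_{1,k}P₀)⁻¹P₀H*_{1,k}J_{k,Z}. (1.13) Using Proposition 4 [15] and the fixed point
theorem for contractive mappings, we can easily prove that the above equation has exactly one solution, which has a
bound equal to twice a bound of the right-hand side of the equation, i.e., it can be bounded by 2γ₀⁻¹2d(100M)⁵B₃²4ε_k.
This proves the existence and the uniqueness statements of Proposition 1 [IV], and the bound (1.78) [IV]."*  The two
halves exist in the tree separately — the equivalence (1.12) ⇔ (1.13) in the gauge subspace (`B16Eq112.eq112_iff_eq113`,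
r13 gen 3, over real inner-product spaces `E` (fields `B′`), `F` (fields on `T_η`), `P₀` the gauge projection, `Kinv` the
inverse of `K = P₀H*Δ₁HP₀` on `P₀E`) and the Banach contraction scheme (`B16Sect1Kernels.fixedPoint_twice_bound`, r13
gen 1: `x + 𝒦x = c`, `𝒦0 = 0`, `𝒦` ½-Lipschitz on the ball of radius `2‖c‖` ⇒ exactly one solution there, `‖x‖ ≤ 2‖c‖`).
HERE they are ASSEMBLED into the printed conclusion in that abstract model: **`prop1IV_model`** — exactly one
configuration `B′` in the gauge subspace with `‖B′‖ ≤ 2‖(P₀H*Δ₁HP₀)⁻¹P₀H*J‖` satisfying the criticality equation (1.12)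
for every gauge variation, under `(δ/δA)V(0) = 0` and the ½-Lipschitz property of `B′ ↦ K⁻¹P₀H*((δ/δA)V)(HB′)` on
that ball; and **`prop1IV_model_of_bounds`** — the same with the Lipschitz property DERIVED from operator bounds
`‖K⁻¹P₀H*z‖ ≤ κ₁‖z‖` (the inverse bound `γ₀⁻¹2d(100M)⁵` of (1.9) times `‖H*‖`), `‖Hx‖ ≤ h₁‖x‖`, a Lipschitz constant `ℓ`
of `(δ/δA)V` on the ball of radius `h₁·2‖c‖` (*"Proposition 4 [15]"* = [Balaban1985Variational] Prop. 4: `V` is of third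
order, so `ℓ` is small for small fields) and the smallness `κ₁ℓh₁ ≤ ½`.  Theorems only; Mathlib + the two r13 files;
no `sorry`.  (The printed numerical bound `2γ₀⁻¹2d(100M)⁵B₃²4ε_k` is `2‖c‖` with `‖c‖ ≤ γ₀⁻¹2d(100M)⁵·B₃²4ε_k`, the
bookkeeping of `B16.prop1_chain_M7`; not repeated.)
-/

namespace Literature.MathematicalPhysics.QuantumFieldTheory.Balaban1983to89.B16Prop1IVAssembly

open scoped RealInnerProductSpace
open Literature.MathematicalPhysics.QuantumFieldTheory.Balaban1983to89

variable {E F : Type*} [NormedAddCommGroup E] [InnerProductSpace ℝ E] [CompleteSpace E]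
  [NormedAddCommGroup F] [InnerProductSpace ℝ F]

/-- **Proposition 1 [IV] as proved on p. 359, abstract real-Hilbert model.**  Data: gauge projection `P₀` (idempotent,
symmetric), `H = H_{1,k}`, `Hst = H*_{1,k}`, `Δ₁ = Δ₁(ζ₀)`, `dV = (δ/δA)V`, current `J = J_{k,Z}`, `Kinv =
(P₀H*Δ₁HP₀)⁻¹` on the gauge subspace (`hKl`, `hKr`, `hKP`, `hPK`); hypotheses: `dV 0 = 0` (V is of third order) and the
½-Lipschitz property of `B′ ↦ K⁻¹P₀H*dV(HB′)` on the ball of radius `2‖c‖`, `c = −K⁻¹P₀H*J` (*"Using Proposition 4 [15]"*).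
Conclusion: *"exactly one solution, which has a bound equal to twice a bound of the right-hand side"* — there is exactly
one `B′` in the gauge subspace with `‖B′‖ ≤ 2‖K⁻¹P₀H*J‖` satisfying (1.12) for all gauge variations `δB′`.
[cite: Balaban1989LargeFieldII, p.359 (after (1.13))] -/
theorem prop1IV_model {P₀ : E →ₗ[ℝ] E} (hP2 : ∀ x, P₀ (P₀ x) = P₀ x) (hPsa : ∀ x y, ⟪P₀ x, y⟫ = ⟪x, P₀ y⟫)
    (H : E →ₗ[ℝ] F) (Hst : F →ₗ[ℝ] E) (Δ₁ : F →ₗ[ℝ] F) (dV : F → F) (J : F) {Kinv : E →ₗ[ℝ] E}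
    (hKl : ∀ x, Kinv (P₀ (Hst (Δ₁ (H (P₀ x))))) = P₀ x) (hKr : ∀ x, P₀ (Hst (Δ₁ (H (P₀ (Kinv x))))) = P₀ x)
    (hKP : ∀ x, Kinv (P₀ x) = Kinv x) (hPK : ∀ x, P₀ (Kinv x) = Kinv x) (hdV0 : dV 0 = 0)
    (hLip : ∀ x y : E, ‖x‖ ≤ 2 * ‖Kinv (P₀ (Hst J))‖ → ‖y‖ ≤ 2 * ‖Kinv (P₀ (Hst J))‖ →
      ‖Kinv (P₀ (Hst (dV (H x)))) - Kinv (P₀ (Hst (dV (H y))))‖ ≤ 1 / 2 * ‖x - y‖) :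
    ∃ B : E, (P₀ B = B ∧ ‖B‖ ≤ 2 * ‖Kinv (P₀ (Hst J))‖ ∧
        ∀ δB : E, P₀ δB = δB → ⟪δB, Hst J⟫ + ⟪δB, Hst (Δ₁ (H B))⟫ + ⟪δB, Hst (dV (H B))⟫ = 0) ∧
      ∀ B' : E, P₀ B' = B' → ‖B'‖ ≤ 2 * ‖Kinv (P₀ (Hst J))‖ →
        (∀ δB : E, P₀ δB = δB → ⟪δB, Hst J⟫ + ⟪δB, Hst (Δ₁ (H B'))⟫ + ⟪δB, Hst (dV (H B'))⟫ = 0) → B' = B := by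
  -- the fixed-point map of (1.13) and its right-hand side
  set 𝒦 : E → E := fun x => Kinv (P₀ (Hst (dV (H x)))) with h𝒦
  set c : E := -Kinv (P₀ (Hst J)) with hc
  have hc_norm : ‖c‖ = ‖Kinv (P₀ (Hst J))‖ := by rw [hc, norm_neg]
  have h𝒦0 : 𝒦 0 = 0 := by simp [h𝒦, hdV0]
  have hLip' : ∀ x y : E, ‖x‖ ≤ 2 * ‖c‖ → ‖y‖ ≤ 2 * ‖c‖ → ‖𝒦 x - 𝒦 y‖ ≤ 1 / 2 * ‖x - y‖ := by
    intro x y hx hy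
    rw [hc_norm] at hx hy
    exact hLip x y hx hy
  obtain ⟨x, ⟨hxn, hxeq⟩, huniq⟩ := B16Sect1Kernels.fixedPoint_twice_bound 𝒦 c h𝒦0 hLip'
  -- the solution lies in the gauge subspace: x = c − 𝒦x and both summands are in the range of Kinv
  have hxg : P₀ x = x := by
    have hx' : x = c - 𝒦 x := eq_sub_of_add_eq hxeq
    rw [hx', map_sub, hc, map_neg, hPK, h𝒦]
    simp only [hPK]
  have h113 : x + Kinv (P₀ (Hst (dV (H x)))) = -Kinv (P₀ (Hst J)) := hxeq
  refine ⟨x, ⟨hxg, hc_norm ▸ hxn, ?_⟩, ?_⟩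
  · exact fun δB hδ => B16Eq112.eq112_of_eq113 hP2 hPsa H Hst Δ₁ dV J hKl hKr hKP hxg h113 δB hδ
  · intro B' hB'g hB'n h112
    have h113' : B' + Kinv (P₀ (Hst (dV (H B')))) = -Kinv (P₀ (Hst J)) :=
      (B16Eq112.eq112_iff_eq113 hP2 hPsa H Hst Δ₁ dV J hKl hKr hKP hB'g).mp h112
    exact huniq B' (hc_norm ▸ hB'n) h113'

omit [CompleteSpace E] in
/-- The ½-Lipschitz hypothesis DERIVED from operator bounds, as the text indicates (*"By the inequality (1.9) the operator
P₀H*_{1,k}Δ₁H_{1,k}P₀ is positive, hence invertible on this subspace, and the inverse is bounded by γ₀⁻¹2d(100M)⁵"* +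
*"Proposition 4 [15]"*): if `‖K⁻¹P₀H*z‖ ≤ κ₁‖z‖`, `‖Hx‖ ≤ h₁‖x‖`, `dV` is `ℓ`-Lipschitz on the ball of radius `ρ ≥ h₁r`
of `F`, and `κ₁ℓh₁ ≤ ½`, then `B′ ↦ K⁻¹P₀H*dV(HB′)` is ½-Lipschitz on the ball of radius `r`.
[cite: Balaban1989LargeFieldII, p.359 (after (1.13))] -/
theorem lipschitz_of_bounds {P₀ : E →ₗ[ℝ] E} (H : E →ₗ[ℝ] F) (Hst : F →ₗ[ℝ] E) (dV : F → F) (Kinv : E →ₗ[ℝ] E)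
    {κ₁ h₁ ℓ ρ r : ℝ} (hκ₁ : 0 ≤ κ₁) (hh₁ : 0 ≤ h₁) (hℓ : 0 ≤ ℓ)
    (hKop : ∀ z : F, ‖Kinv (P₀ (Hst z))‖ ≤ κ₁ * ‖z‖) (hH : ∀ x : E, ‖H x‖ ≤ h₁ * ‖x‖)
    (hdV : ∀ u v : F, ‖u‖ ≤ ρ → ‖v‖ ≤ ρ → ‖dV u - dV v‖ ≤ ℓ * ‖u - v‖) (hρ : h₁ * r ≤ ρ)
    (hsmall : κ₁ * ℓ * h₁ ≤ 1 / 2) :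
    ∀ x y : E, ‖x‖ ≤ r → ‖y‖ ≤ r →
      ‖Kinv (P₀ (Hst (dV (H x)))) - Kinv (P₀ (Hst (dV (H y))))‖ ≤ 1 / 2 * ‖x - y‖ := by
  intro x y hx hy
  have hHx : ‖H x‖ ≤ ρ := (hH x).trans ((mul_le_mul_of_nonneg_left hx hh₁).trans hρ)
  have hHy : ‖H y‖ ≤ ρ := (hH y).trans ((mul_le_mul_of_nonneg_left hy hh₁).trans hρ)
  have h1 : Kinv (P₀ (Hst (dV (H x)))) - Kinv (P₀ (Hst (dV (H y)))) =
      Kinv (P₀ (Hst (dV (H x) - dV (H y)))) := by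
    rw [map_sub Hst, map_sub P₀, map_sub Kinv]
  rw [h1]
  have h2 : ‖dV (H x) - dV (H y)‖ ≤ ℓ * ‖H x - H y‖ := hdV _ _ hHx hHy
  have h3 : ‖H x - H y‖ ≤ h₁ * ‖x - y‖ := by rw [← map_sub]; exact hH _
  calc ‖Kinv (P₀ (Hst (dV (H x) - dV (H y))))‖ ≤ κ₁ * ‖dV (H x) - dV (H y)‖ := hKop _
    _ ≤ κ₁ * (ℓ * (h₁ * ‖x - y‖)) :=
        mul_le_mul_of_nonneg_left (h2.trans (mul_le_mul_of_nonneg_left h3 hℓ)) hκ₁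
    _ = (κ₁ * ℓ * h₁) * ‖x - y‖ := by ring
    _ ≤ 1 / 2 * ‖x - y‖ := mul_le_mul_of_nonneg_right hsmall (norm_nonneg _)

/-- **Proposition 1 [IV] (p. 359), abstract model, from operator bounds**: `prop1IV_model` with its contraction
hypothesis discharged by `lipschitz_of_bounds` — the inverse bound `κ₁` (from (1.9)), `‖H_{1,k}‖ ≤ h₁`, the Lipschitz
constant `ℓ` of `(δ/δA)V` on the ball of radius `ρ ≥ h₁·2‖K⁻¹P₀H*J‖` (Proposition 4 [15]) and `κ₁ℓh₁ ≤ ½`.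
[cite: Balaban1989LargeFieldII, p.359 (after (1.13))] -/
theorem prop1IV_model_of_bounds {P₀ : E →ₗ[ℝ] E} (hP2 : ∀ x, P₀ (P₀ x) = P₀ x)
    (hPsa : ∀ x y, ⟪P₀ x, y⟫ = ⟪x, P₀ y⟫) (H : E →ₗ[ℝ] F) (Hst : F →ₗ[ℝ] E) (Δ₁ : F →ₗ[ℝ] F) (dV : F → F)
    (J : F) {Kinv : E →ₗ[ℝ] E} (hKl : ∀ x, Kinv (P₀ (Hst (Δ₁ (H (P₀ x))))) = P₀ x)
    (hKr : ∀ x, P₀ (Hst (Δ₁ (H (P₀ (Kinv x))))) = P₀ x) (hKP : ∀ x, Kinv (P₀ x) = Kinv x)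
    (hPK : ∀ x, P₀ (Kinv x) = Kinv x) (hdV0 : dV 0 = 0) {κ₁ h₁ ℓ ρ : ℝ} (hκ₁ : 0 ≤ κ₁) (hh₁ : 0 ≤ h₁)
    (hℓ : 0 ≤ ℓ) (hKop : ∀ z : F, ‖Kinv (P₀ (Hst z))‖ ≤ κ₁ * ‖z‖) (hH : ∀ x : E, ‖H x‖ ≤ h₁ * ‖x‖)
    (hdV : ∀ u v : F, ‖u‖ ≤ ρ → ‖v‖ ≤ ρ → ‖dV u - dV v‖ ≤ ℓ * ‖u - v‖)
    (hρ : h₁ * (2 * ‖Kinv (P₀ (Hst J))‖) ≤ ρ) (hsmall : κ₁ * ℓ * h₁ ≤ 1 / 2) :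
    ∃ B : E, (P₀ B = B ∧ ‖B‖ ≤ 2 * ‖Kinv (P₀ (Hst J))‖ ∧
        ∀ δB : E, P₀ δB = δB → ⟪δB, Hst J⟫ + ⟪δB, Hst (Δ₁ (H B))⟫ + ⟪δB, Hst (dV (H B))⟫ = 0) ∧
      ∀ B' : E, P₀ B' = B' → ‖B'‖ ≤ 2 * ‖Kinv (P₀ (Hst J))‖ →
        (∀ δB : E, P₀ δB = δB → ⟪δB, Hst J⟫ + ⟪δB, Hst (Δ₁ (H B'))⟫ + ⟪δB, Hst (dV (H B'))⟫ = 0) → B' = B :=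
  prop1IV_model hP2 hPsa H Hst Δ₁ dV J hKl hKr hKP hPK hdV0
    (lipschitz_of_bounds H Hst dV Kinv hκ₁ hh₁ hℓ hKop hH hdV hρ hsmall)

/-! ## §2 (v1.1, r13 gen 16, append-only) «By the inequality (1.9) the operator P₀H*Δ₁HP₀ is positive, hence invertible on this subspace, and the inverse is bounded by γ₀⁻¹2d(100M)⁵» — the inverse DERIVED (finite dimension)

p. 359 [PDF 5], verbatim (text layer `p0005.txt` L13–L16, render p005 read by r13 gens 1/3): *«Denote by P₀ the projection
onto the subspace of B′ satisfying the gauge condition B′↾_{G₀} = 0. By the inequality (1.9) the operator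
P₀H*_{1,k}Δ₁H_{1,k}P₀ is positive, hence invertible on this subspace, and the inverse is bounded by γ₀⁻¹2d(100M)⁵.»*
§1 above takes the inverse `Kinv` as DATA with the four identities `hKl/hKr/hKP/hPK` and the operator bound `hKop` as
HYPOTHESES (the §2f.3 owner reading of row B16.Prop1[IV], HOME/INBOX 2026-08-22T02:28Z: «inverse EXISTENCE assumed»).
Here that step is PROVED in the abstract model, for a FINITE-DIMENSIONAL field space `E` (the physical `E` = 𝔤-valued
bond fields `B′` on the finite box `Λ`, so finite-dimensional): from the (1.9)-shaped positivity
`c‖B′‖² ≤ ⟨H B′, Δ₁ H B′⟩` on the gauge subspace (`c = γ₀/(2d(100M)⁵)` in print; row B16.Eq1.9, `B16Sect1Wilson.Ineq19`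
with `Q = ⟨H_{1,k}B′, Δ₁(ζ₀)H_{1,k}B′⟩`, `nB = ‖B′‖²`), `H* = Hst` the adjoint of `H` and `P₀` an idempotent symmetric
projection, **`exists_inverse_of_pos`** constructs `Kinv` with `hKl/hKr/hKP/hPK` AND the printed bound
`‖K⁻¹w‖ ≤ c⁻¹‖P₀w‖` («the inverse is bounded by γ₀⁻¹2d(100M)⁵»); **`norm_proj_le`** is `‖P₀y‖ ≤ ‖y‖`;
**`prop1IV_model_of_pos`** = Proposition 1 [IV] in the model with the inverse no longer assumed: hypotheses are the
positivity constant `c > 0` ((1.9)), `‖H‖ ≤ h₁`, `‖H*‖ ≤ hst`, `dV 0 = 0` and a Lipschitz constant `ℓ` of `(δ/δA)V` on the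
ball of radius `ρ ≥ h₁·2c⁻¹hst‖J‖` (Proposition 4 [15]) and `c⁻¹·hst·ℓ·h₁ ≤ ½`; conclusion: an inverse `Kinv` with the
four identities and the bound, and exactly one critical `B′` in the gauge subspace with
`‖B′‖ ≤ 2‖K⁻¹P₀H*J‖ ≤ 2c⁻¹hst‖J‖` («twice a bound of the right-hand side»).  Mathlib: `LinearEquiv.ofInjectiveEndo`
(injective endomorphism of a finite-dimensional space is invertible).  HONEST SCOPE: finite dimension is used for
«positive ⇒ invertible» (in print the spaces are finite-dimensional); (1.9) itself stays the typed leaf / box-chart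
theorem of row B16.Eq1.9 and enters as the hypothesis `hpos`; nothing about `H_{1,k}`, `Δ₁(ζ₀)`, `V` is constructed. -/

section InverseFromPositivity

omit [CompleteSpace E] in
/-- `‖P₀ y‖ ≤ ‖y‖` for an idempotent symmetric `P₀` (orthogonal projection). [cite: Balaban1989LargeFieldII, p.359 («Denote
by P₀ the projection onto the subspace of B′ satisfying the gauge condition»)] -/
theorem norm_proj_le {P₀ : E →ₗ[ℝ] E} (hP2 : ∀ x, P₀ (P₀ x) = P₀ x) (hPsa : ∀ x y, ⟪P₀ x, y⟫ = ⟪x, P₀ y⟫) (y : E) :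
    ‖P₀ y‖ ≤ ‖y‖ := by
  have h : ‖P₀ y‖ ^ 2 ≤ ‖y‖ * ‖P₀ y‖ := by
    calc ‖P₀ y‖ ^ 2 = ⟪P₀ y, P₀ y⟫ := (real_inner_self_eq_norm_sq _).symm
      _ = ⟪y, P₀ (P₀ y)⟫ := hPsa _ _
      _ = ⟪y, P₀ y⟫ := by rw [hP2]
      _ ≤ ‖y‖ * ‖P₀ y‖ := real_inner_le_norm _ _
  by_cases h0 : ‖P₀ y‖ = 0
  · rw [h0]; exact norm_nonneg _
  · have hp : 0 < ‖P₀ y‖ := lt_of_le_of_ne (norm_nonneg _) (Ne.symm h0)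
    nlinarith

omit [CompleteSpace E] in
/-- **«By the inequality (1.9) the operator P₀H*Δ₁HP₀ is positive, hence invertible on this subspace, and the inverse is
bounded by γ₀⁻¹2d(100M)⁵»** (p. 359) — PROVED for finite-dimensional `E`: from `c‖x‖² ≤ ⟨Hx, Δ₁Hx⟩` on the gauge
subspace `{x | P₀x = x}` (`c > 0`; (1.9) with `c = γ₀/(2d(100M)⁵)`), `Hst` the adjoint of `H`, `P₀` idempotent symmetric,
there is a linear `Kinv` — the inverse of `K = P₀HstΔ₁HP₀` on the gauge subspace, composed with `P₀` — with
`Kinv(K(P₀x)) = P₀x`, `K(Kinv x) = P₀x`, `Kinv ∘ P₀ = Kinv`, `P₀ ∘ Kinv = Kinv` and `‖Kinv x‖ ≤ c⁻¹‖P₀x‖`.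
[cite: Balaban1989LargeFieldII, p.359 (between (1.12) and (1.13)); (1.9) p.358] -/
theorem exists_inverse_of_pos [FiniteDimensional ℝ E] {P₀ : E →ₗ[ℝ] E} (hP2 : ∀ x, P₀ (P₀ x) = P₀ x)
    (hPsa : ∀ x y, ⟪P₀ x, y⟫ = ⟪x, P₀ y⟫) (H : E →ₗ[ℝ] F) (Hst : F →ₗ[ℝ] E)
    (hadj : ∀ (x : E) (y : F), ⟪H x, y⟫ = ⟪x, Hst y⟫) (Δ₁ : F →ₗ[ℝ] F) {c : ℝ} (hc : 0 < c)
    (hpos : ∀ x, P₀ x = x → c * ‖x‖ ^ 2 ≤ ⟪H x, Δ₁ (H x)⟫) :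
    ∃ Kinv : E →ₗ[ℝ] E, (∀ x, Kinv (P₀ (Hst (Δ₁ (H (P₀ x))))) = P₀ x) ∧
      (∀ x, P₀ (Hst (Δ₁ (H (P₀ (Kinv x))))) = P₀ x) ∧ (∀ x, Kinv (P₀ x) = Kinv x) ∧
      (∀ x, P₀ (Kinv x) = Kinv x) ∧ ∀ x, ‖Kinv x‖ ≤ c⁻¹ * ‖P₀ x‖ := by
  -- the gauge subspace `V = range P₀ = {x | P₀ x = x}` and `K = P₀ Hst Δ₁ H` restricted to it
  set V : Submodule ℝ E := LinearMap.range P₀ with hV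
  have hmemV : ∀ {x : E}, x ∈ V → P₀ x = x := by
    rintro x ⟨y, rfl⟩; exact hP2 y
  set Kf : E →ₗ[ℝ] E := P₀ ∘ₗ Hst ∘ₗ Δ₁ ∘ₗ H with hKf
  have hKf_apply : ∀ x, Kf x = P₀ (Hst (Δ₁ (H x))) := fun x => rfl
  have hmaps : ∀ v ∈ V, Kf v ∈ V := fun v _ => ⟨Hst (Δ₁ (H v)), rfl⟩
  set K' : V →ₗ[ℝ] V := Kf.restrict hmaps with hK'
  have hK'_coe : ∀ v : V, ((K' v : V) : E) = P₀ (Hst (Δ₁ (H (v : E)))) := fun v => rfl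
  -- coercivity of `K'` on `V` (this is where (1.9), the adjoint and the symmetry of `P₀` enter)
  have hcoer : ∀ v : V, c * ‖(v : E)‖ ^ 2 ≤ ⟪(v : E), ((K' v : V) : E)⟫ := by
    intro v
    have hv : P₀ (v : E) = v := hmemV v.2
    calc c * ‖(v : E)‖ ^ 2 ≤ ⟪H (v : E), Δ₁ (H (v : E))⟫ := hpos _ hv
      _ = ⟪(v : E), Hst (Δ₁ (H (v : E)))⟫ := hadj _ _
      _ = ⟪P₀ (v : E), Hst (Δ₁ (H (v : E)))⟫ := by rw [hv]
      _ = ⟪(v : E), P₀ (Hst (Δ₁ (H (v : E))))⟫ := hPsa _ _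
      _ = ⟪(v : E), ((K' v : V) : E)⟫ := by rw [hK'_coe]
  -- the bound `c‖v‖ ≤ ‖K' v‖`, hence injectivity
  have hlow : ∀ v : V, c * ‖(v : E)‖ ≤ ‖((K' v : V) : E)‖ := by
    intro v
    have h1 := hcoer v
    have h2 : ⟪(v : E), ((K' v : V) : E)⟫ ≤ ‖(v : E)‖ * ‖((K' v : V) : E)‖ := real_inner_le_norm _ _
    by_cases h0 : ‖(v : E)‖ = 0
    · rw [h0, mul_zero]; exact norm_nonneg _
    · have hp : 0 < ‖(v : E)‖ := lt_of_le_of_ne (norm_nonneg _) (Ne.symm h0)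
      nlinarith
  have hinj : Function.Injective K' := by
    intro v w hvw
    have h0 : K' (v - w) = 0 := by rw [map_sub, hvw, sub_self]
    have h1 := hlow (v - w)
    rw [h0] at h1
    simp only [ZeroMemClass.coe_zero, norm_zero] at h1
    have h2 : ‖((v - w : V) : E)‖ ≤ 0 := by nlinarith [norm_nonneg ((v - w : V) : E)]
    have h3 : ((v - w : V) : E) = 0 := norm_le_zero_iff.mp h2
    exact sub_eq_zero.mp (by exact_mod_cast h3)
  set Keq : V ≃ₗ[ℝ] V := LinearEquiv.ofInjectiveEndo K' hinj with hKeq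
  have hKeq_apply : ∀ v : V, Keq v = K' v := fun v => rfl
  -- `Kinv = ι ∘ K'⁻¹ ∘ (P₀ as a map into V)`
  set R : E →ₗ[ℝ] V := P₀.rangeRestrict with hR
  have hR_coe : ∀ x, ((R x : V) : E) = P₀ x := fun x => rfl
  refine ⟨V.subtype ∘ₗ (Keq.symm : V →ₗ[ℝ] V) ∘ₗ R, ?_, ?_, ?_, ?_, ?_⟩
  · -- `Kinv (K (P₀ x)) = P₀ x`
    intro x
    have hRx : R (P₀ (Hst (Δ₁ (H (P₀ x))))) = K' (R x) := by
      apply Subtype.ext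
      rw [hR_coe, hK'_coe, hR_coe, hP2]
    show ((Keq.symm (R (P₀ (Hst (Δ₁ (H (P₀ x)))))) : V) : E) = P₀ x
    rw [hRx, ← hKeq_apply, LinearEquiv.symm_apply_apply, hR_coe]
  · -- `K (Kinv x) = P₀ x`
    intro x
    show P₀ (Hst (Δ₁ (H (P₀ ((Keq.symm (R x) : V) : E))))) = P₀ x
    rw [hmemV (Keq.symm (R x)).2, ← hK'_coe, ← hKeq_apply, LinearEquiv.apply_symm_apply, hR_coe]
  · -- `Kinv (P₀ x) = Kinv x`
    intro x
    have hRx : R (P₀ x) = R x := by apply Subtype.ext; rw [hR_coe, hR_coe, hP2]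
    show ((Keq.symm (R (P₀ x)) : V) : E) = ((Keq.symm (R x) : V) : E)
    rw [hRx]
  · -- `P₀ (Kinv x) = Kinv x`
    intro x
    exact hmemV (Keq.symm (R x)).2
  · -- the printed bound `‖K⁻¹ w‖ ≤ c⁻¹ ‖w‖` on the gauge subspace
    intro x
    show ‖((Keq.symm (R x) : V) : E)‖ ≤ c⁻¹ * ‖P₀ x‖
    have h1 := hlow (Keq.symm (R x))
    rw [← hKeq_apply, LinearEquiv.apply_symm_apply, hR_coe] at h1
    rw [le_inv_mul_iff₀ hc]
    exact h1

/-- **Proposition 1 [IV] (p. 359), abstract model, with the inverse DERIVED from the (1.9) positivity** (finite-dimensional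
`E`): `prop1IV_model_of_bounds` ∘ `exists_inverse_of_pos`, the operator bound `κ₁ = c⁻¹·hst` obtained from
`‖K⁻¹w‖ ≤ c⁻¹‖P₀w‖`, `‖P₀y‖ ≤ ‖y‖` and `‖H*z‖ ≤ hst‖z‖`.  Hypotheses: `P₀` idempotent symmetric, `Hst` the adjoint of
`H`, positivity constant `c > 0` on the gauge subspace ((1.9)), `dV 0 = 0` and an `ℓ`-Lipschitz bound for `dV = (δ/δA)V` on
the ball of radius `ρ ≥ h₁·(2c⁻¹hst‖J‖)` (Proposition 4 [15]), `‖H‖ ≤ h₁`, `‖H*‖ ≤ hst`, smallness `c⁻¹hst·ℓ·h₁ ≤ ½`.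
Conclusion: an inverse `Kinv` as in `exists_inverse_of_pos` and exactly one critical configuration `B′` of (1.12) in the
gauge subspace with `‖B′‖ ≤ 2‖K⁻¹P₀H*J‖` — *«twice a bound of the right-hand side»* — and `2‖K⁻¹P₀H*J‖ ≤ 2c⁻¹hst‖J‖`.
[cite: Balaban1989LargeFieldII, p.359 (proof of Proposition 1 [IV]); (1.9) p.358; Balaban1985Variational, Prop. 4] -/
theorem prop1IV_model_of_pos [FiniteDimensional ℝ E] {P₀ : E →ₗ[ℝ] E} (hP2 : ∀ x, P₀ (P₀ x) = P₀ x)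
    (hPsa : ∀ x y, ⟪P₀ x, y⟫ = ⟪x, P₀ y⟫) (H : E →ₗ[ℝ] F) (Hst : F →ₗ[ℝ] E)
    (hadj : ∀ (x : E) (y : F), ⟪H x, y⟫ = ⟪x, Hst y⟫) (Δ₁ : F →ₗ[ℝ] F) (dV : F → F) (J : F) {c : ℝ} (hc : 0 < c)
    (hpos : ∀ x, P₀ x = x → c * ‖x‖ ^ 2 ≤ ⟪H x, Δ₁ (H x)⟫) (hdV0 : dV 0 = 0) {h₁ hst ℓ ρ : ℝ}
    (hh₁ : 0 ≤ h₁) (hhst : 0 ≤ hst) (hℓ : 0 ≤ ℓ) (hH : ∀ x : E, ‖H x‖ ≤ h₁ * ‖x‖)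
    (hHst : ∀ z : F, ‖Hst z‖ ≤ hst * ‖z‖)
    (hdV : ∀ u v : F, ‖u‖ ≤ ρ → ‖v‖ ≤ ρ → ‖dV u - dV v‖ ≤ ℓ * ‖u - v‖)
    (hρ : h₁ * (2 * (c⁻¹ * hst * ‖J‖)) ≤ ρ) (hsmall : c⁻¹ * hst * ℓ * h₁ ≤ 1 / 2) :
    ∃ Kinv : E →ₗ[ℝ] E, ((∀ x, Kinv (P₀ (Hst (Δ₁ (H (P₀ x))))) = P₀ x) ∧
        (∀ x, P₀ (Hst (Δ₁ (H (P₀ (Kinv x))))) = P₀ x) ∧ (∀ x, Kinv (P₀ x) = Kinv x) ∧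
        (∀ x, P₀ (Kinv x) = Kinv x) ∧ ∀ x, ‖Kinv x‖ ≤ c⁻¹ * ‖P₀ x‖) ∧
      2 * ‖Kinv (P₀ (Hst J))‖ ≤ 2 * (c⁻¹ * hst * ‖J‖) ∧
      ∃ B : E, (P₀ B = B ∧ ‖B‖ ≤ 2 * ‖Kinv (P₀ (Hst J))‖ ∧
          ∀ δB : E, P₀ δB = δB → ⟪δB, Hst J⟫ + ⟪δB, Hst (Δ₁ (H B))⟫ + ⟪δB, Hst (dV (H B))⟫ = 0) ∧
        ∀ B' : E, P₀ B' = B' → ‖B'‖ ≤ 2 * ‖Kinv (P₀ (Hst J))‖ →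
          (∀ δB : E, P₀ δB = δB → ⟪δB, Hst J⟫ + ⟪δB, Hst (Δ₁ (H B'))⟫ + ⟪δB, Hst (dV (H B'))⟫ = 0) →
            B' = B := by
  obtain ⟨Kinv, hKl, hKr, hKP, hPK, hbd⟩ := exists_inverse_of_pos hP2 hPsa H Hst hadj Δ₁ hc hpos
  have hκ₁ : 0 ≤ c⁻¹ * hst := mul_nonneg (inv_nonneg.mpr hc.le) hhst
  have hKop : ∀ z : F, ‖Kinv (P₀ (Hst z))‖ ≤ c⁻¹ * hst * ‖z‖ := by
    intro z
    calc ‖Kinv (P₀ (Hst z))‖ ≤ c⁻¹ * ‖P₀ (P₀ (Hst z))‖ := hbd _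
      _ = c⁻¹ * ‖P₀ (Hst z)‖ := by rw [hP2]
      _ ≤ c⁻¹ * ‖Hst z‖ := mul_le_mul_of_nonneg_left (norm_proj_le hP2 hPsa _) (inv_nonneg.mpr hc.le)
      _ ≤ c⁻¹ * (hst * ‖z‖) := mul_le_mul_of_nonneg_left (hHst z) (inv_nonneg.mpr hc.le)
      _ = c⁻¹ * hst * ‖z‖ := by ring
  have hJ : 2 * ‖Kinv (P₀ (Hst J))‖ ≤ 2 * (c⁻¹ * hst * ‖J‖) :=
    mul_le_mul_of_nonneg_left (hKop J) (by norm_num)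
  have hρ' : h₁ * (2 * ‖Kinv (P₀ (Hst J))‖) ≤ ρ := (mul_le_mul_of_nonneg_left hJ hh₁).trans hρ
  exact ⟨Kinv, ⟨hKl, hKr, hKP, hPK, hbd⟩, hJ,
    prop1IV_model_of_bounds hP2 hPsa H Hst Δ₁ dV J hKl hKr hKP hPK hdV0 hκ₁ hh₁ hℓ hKop hH hdV hρ' hsmall⟩

end InverseFromPositivity

end Literature.MathematicalPhysics.QuantumFieldTheory.Balaban1983to89.B16Prop1IVAssembly
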